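import Literature.NumberTheory.IwasawaTheory.NarrowFukudaRankProofs
import Literature.NumberTheory.IwasawaTheory.FukudaGroupLayers
import Literature.NumberTheory.IwasawaTheory.FukudaRankJumpAlgebra
import HarnessLib

/-!
# THE NARROW RANK-JUMP DOOR: `rank_p Cl⁺(K_{n+k}) - rank_p Cl⁺(K_{n+j}) < p^k - p^j` for ONE pair of layers `n + j ≤ n + k` (`n ≥` Fukuda's index)
# freezes the NARROW `p`-ranks from `n + k` — hence `μ = 0` and, at `p = 2`, a bounded narrow `2`-defect (proved, finite level)

`Proofs`-style file (theorems only: no definition, no named fact, no `sorry`) in topic `NumberTheory/IwasawaTheory` (namespace = path),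
written by the prover seat `bsd-line-att-p3` g40 (cell `bsd-f1-sign2`, WIDTH-5 attach on route `AlignedTransportAtTwo`; `--supports`
stmt-BirchSwinnertonDyer-22298, closes nothing; no class group is computed here).  The NARROW twin of this seat's `ClassGroupPRankStableOfRankJumpLt`
(wide class groups), obtained from cell `bsd-2adic`'s narrow package `NarrowFukuda.exists_layer_package` exactly as `NarrowFukudaRankProofs`
(narrow Fukuda, the jump-`0` case) is obtained from it.

THE THEOREM (`NarrowFukuda.index_range_pow_narrowClassGroup_eq_of_mul_pow_lt`).  `K` a number field, `p` a prime, `κ` a `ℤ_p`-extension of `K`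
with Fukuda index `n₀` (`TotallyRamifiedFrom κ n₀`), `n ≥ n₀`, `j ≤ k`, narrow ranks written as indices `I_m = [Cl⁺(K_m) : Cl⁺(K_m)^p] = p^{r⁺_m}`.
IF `I_{n+k} · p^{p^j} < I_{n+j} · p^{p^k}` — i.e. `r⁺_{n+k} - r⁺_{n+j} < p^k - p^j` — THEN `I_m = I_{n+k}` for every `m ≥ n + k`.  Consequently the
narrow `p`-ranks are bounded along the tower (`…exists_forall_padicValNat_index_le_of_mul_pow_lt`), Iwasawa's `μ = 0` holds for `κ`
(`…classicalMuVanishes_of_mul_pow_lt`, as `rank_p Cl ≤ rank_p Cl⁺`), and at `p = 2` the narrow defect `ord₂ h⁺(K_m) − ord₂ h(K_m)` is bounded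
(`…exists_narrowDefect_le_of_mul_pow_lt`) — the two inputs of the Kida-lite ascent `K ↦ K(√−1)` (cell bsd-2adic GEN 8) behind the cell's
named C2-input «narrow `μ₂⁺ = 0` for non-cyclic totally real cubic fields».  `p = 2`, `(j,k) = (1,2)`: **`[Cl⁺(K_{n+2}) : Cl⁺(K_{n+2})²] ≤
2·[Cl⁺(K_{n+1}) : Cl⁺(K_{n+1})²]`**, i.e. the narrow `2`-rank grows by at most one from `K_{n+1}` to `K_{n+2}` (§3), where narrow Fukuda needs equality;
by `NarrowRankJumpLayerOne` / `NarrowRankLayerPairExact` the pair `(0,1)` can never certify a totally real field of odd degree with `h⁺` odd and two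
ramified primes in `K(√2)` — the narrow rank jumps there from `0` to exactly `t − 1`.

PROOF.  In the narrow package (`G = Gal(K¹(K_{n+t})/K_n)`, `A ≅ Cl⁺(K_{n+t})` abelian — NOT a `p`-group, which the rank-jump lemma does not need —,
`φ` = conjugation by a totally ramified inertia generator, `Y₀ = N₀ ∩ A` `φ`-stable) one has `I_{n+i} = [G_i : N_iP_i] = #(A/(ν_iY₀ + pA))`
(`FukudaGroup.relIndex_commutator_sup_layer_pow_mul_card`); the rank-jump lemma `FukudaRankJump.card_quotient_eq_of_card_quotient_mul_lt` does the rest.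

References: [Fukuda1994] T. Fukuda, Proc. Japan Acad. 70 A (1994), Thm. 1 (2), p. 264; [Washington1997] §13.3 Lemma 13.18, Prop. 13.22–13.23;
[NeukirchANT1999] Ch. VI §6 Prop. (6.8); [GreenbergLNM1716] §5 p. 122; [FrohlichTaylor1990] Ch. V §1 (1.8)–(1.13); [Kida1982JFields] (narrow μ, shape).
-/

set_option autoImplicit false

noncomputable section

open scoped NumberField IsMulCommutative
open NumberField Field Finset

namespace Literature.NumberTheory.IwasawaTheory

open Literature.NumberTheory.EllipticCurves Literature.NumberTheory.NumberFields

variable {K : Type} [Field K] [NumberField K] {p : ℕ} [hp : Fact p.Prime]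

/-! ## §1 Inside the narrow package: `I_{n+k'} = I_{n+k}` for `k ≤ k' ≤ t` whenever `I_{n+k} · p^{p^j} < I_{n+j} · p^{p^k}` -/

/-- The finite-level step (narrow package of `K_n ⊆ K_{n+t} ⊆ K¹(K_{n+t})`, `1 ≤ t`, `j ≤ k ≤ k' ≤ t`): `I_{n+k} · p^{p^j} < I_{n+j} · p^{p^k}` gives
`I_{n+k'} = I_{n+k}` (`I_i = [Cl⁺(K_i) : Cl⁺(K_i)^p]`). [cite: Fukuda1994, Thm. 1 (2), p. 264 (proof)] [cite: Washington1997, §13.3 Lemma 13.18 and Prop. 13.22] -/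
private theorem narrow_layer_rank_jump (κ : ZpExtension K p) {n₀ n : ℕ} (hκ : TotallyRamifiedFrom κ n₀) (hn : n₀ ≤ n) {j k k' t : ℕ}
    (ht : 1 ≤ t) (hjk : j ≤ k) (hkk' : k ≤ k') (hk't : k' ≤ t)
    [NumberField (κ.layer (n + j))] [NumberField (κ.layer (n + k))] [NumberField (κ.layer (n + k'))]
    (hjump : (powMonoidHom (α := NarrowClassGroup (κ.layer (n + k))) p).range.index * p ^ (p ^ j) <
      (powMonoidHom (α := NarrowClassGroup (κ.layer (n + j))) p).range.index * p ^ (p ^ k)) :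
    (powMonoidHom (α := NarrowClassGroup (κ.layer (n + k'))) p).range.index =
      (powMonoidHom (α := NarrowClassGroup (κ.layer (n + k))) p).range.index := by
  classical
  have hkt : k ≤ t := hkk'.trans hk't
  have hjt : j ≤ t := hjk.trans hkt
  obtain ⟨G, _instG, _instF, A', hA'n, _instC, g, 𝓘, hgA, hgen, hA'index, h𝓘, hg𝓘, hlayer⟩ :=
    NarrowFukuda.exists_layer_package κ hκ hn t ht
  obtain ⟨Gj, hAGj, hGj, hrj⟩ := hlayer j hjt
  obtain ⟨Gk, hAGk, hGk, hrk⟩ := hlayer k hkt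
  obtain ⟨Gk', hAGk', hGk', hrk'⟩ := hlayer k' hk't
  -- the data of the rank-jump lemma
  set Y : Submodule ℤ (Additive A') := FukudaGroup.subOf A' (⁅(⊤ : Subgroup G), ⊤⁆ ⊔ ⨆ I ∈ 𝓘, I) with hY
  set φ : Module.End ℤ (Additive A') := FukudaGroup.conjEnd A' g with hφ
  set P : Submodule ℤ (Additive A') := (⊤ : Submodule ℤ (Additive A')).map ((p : ℤ) • (1 : Module.End ℤ (Additive A')))
    with hP
  have hφt : φ ^ p ^ t = 1 := FukudaGroup.conjEnd_pow_index_eq_one hgA hgen hA'index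
  have hYφ : Y.map φ ≤ Y := by
    rintro _ ⟨y, hy, rfl⟩
    exact FukudaGroup.conjEnd_mem_subOf_commutator_sup hgA hgen hA'index h𝓘 hg𝓘 hy
  -- `#(A/(ν_i Y + pA)) = I_{n+i}` for `i = j, k, k'`
  have hquot : ∀ {i : ℕ} (hi : i ≤ t) {Gi : Subgroup G} (hAGi : A' ≤ Gi) (hGi : Gi.index = p ^ i),
      ((⁅Gi, Gi⁆ ⊔ ⨆ I ∈ 𝓘, I ⊓ Gi) ⊔ Subgroup.closure ((fun x : G => x ^ p) '' (Gi : Set G))).relIndex Gi =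
        Nat.card (Additive A' ⧸ (Y.map (∑ l ∈ range (p ^ i), φ ^ l) ⊔ P)) := by
    intro i hi Gi hAGi hGi
    have hmul := FukudaGroup.relIndex_commutator_sup_layer_pow_mul_card hgA hgen hA'index h𝓘 hg𝓘 hi hAGi hGi
    have hcard : Nat.card A' = Nat.card ↥(Y.map (∑ l ∈ range (p ^ i), φ ^ l) ⊔ P) *
        Nat.card (Additive A' ⧸ (Y.map (∑ l ∈ range (p ^ i), φ ^ l) ⊔ P)) :=
      Submodule.card_eq_card_quotient_mul_card (Y.map (∑ l ∈ range (p ^ i), φ ^ l) ⊔ P)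
    rw [hcard, mul_comm (Nat.card ↥(Y.map _ ⊔ P))] at hmul
    exact Nat.eq_of_mul_eq_mul_right Nat.card_pos hmul
  have hqj := hquot hjt hAGj hGj
  have hqk := hquot hkt hAGk hGk
  have hqk' := hquot hk't hAGk' hGk'
  rw [hrj] at hqj
  rw [hrk] at hqk
  rw [hrk'] at hqk'
  have hlt : Nat.card (Additive A' ⧸ (Y.map (∑ l ∈ range (p ^ k), φ ^ l) ⊔ P)) * p ^ (p ^ j) <
      Nat.card (Additive A' ⧸ (Y.map (∑ l ∈ range (p ^ j), φ ^ l) ⊔ P)) * p ^ (p ^ k) := by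
    rw [← hqj, ← hqk]
    exact hjump
  have heq := FukudaRankJump.card_quotient_eq_of_card_quotient_mul_lt φ hφt Y hYφ hjk hlt hkk'
  rw [← hqk, ← hqk'] at heq
  exact heq

/-! ## §2 The narrow door along the tower -/

/-- ★★ **THE NARROW RANK-JUMP DOOR.**  `κ` a `ℤ_p`-extension of the number field `K` with Fukuda index `n₀`, `n₀ ≤ n`, `j ≤ k`: if
`[Cl⁺(K_{n+k}) : Cl⁺(K_{n+k})^p] · p^{p^j} < [Cl⁺(K_{n+j}) : Cl⁺(K_{n+j})^p] · p^{p^k}` (narrow rank jump `< p^k − p^j`), then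
`[Cl⁺(K_m) : Cl⁺(K_m)^p] = [Cl⁺(K_{n+k}) : Cl⁺(K_{n+k})^p]` for every `m ≥ n + k` (any `NumberField` instances on the layers).  Narrow Fukuda
(`NarrowFukuda.index_range_pow_narrowClassGroup_eq_of_succ_eq`) is the jump-`0` case `(j,k) = (0,1)`.
[cite: Fukuda1994, Thm. 1 (2), p. 264] [cite: Washington1997, §13.3 Prop. 13.22–13.23] [cite: NeukirchANT1999, Ch. VI §6 Prop. (6.8)]
[cite: GreenbergLNM1716, §5, proof of Prop. 5.14 (p. 122)] -/
theorem NarrowFukuda.index_range_pow_narrowClassGroup_eq_of_mul_pow_lt (κ : ZpExtension K p) {n₀ n : ℕ}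
    (hκ : TotallyRamifiedFrom κ n₀) (hn : n₀ ≤ n) {j k : ℕ} (hjk : j ≤ k)
    [NumberField (κ.layer (n + j))] [NumberField (κ.layer (n + k))]
    (hjump : (powMonoidHom (α := NarrowClassGroup (κ.layer (n + k))) p).range.index * p ^ (p ^ j) <
      (powMonoidHom (α := NarrowClassGroup (κ.layer (n + j))) p).range.index * p ^ (p ^ k))
    {m : ℕ} (hm : n + k ≤ m) [NumberField (κ.layer m)] :
    (powMonoidHom (α := NarrowClassGroup (κ.layer m)) p).range.index =
      (powMonoidHom (α := NarrowClassGroup (κ.layer (n + k))) p).range.index := by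
  obtain ⟨k', rfl⟩ : ∃ k', m = n + k' := ⟨m - n, by omega⟩
  exact narrow_layer_rank_jump κ hκ hn (t := k' + 1) (by omega) hjk (by omega) (Nat.le_succ k') hjump

/-- **Bounded narrow `p`-ranks from a small narrow rank jump**: there is `B` with `ord_p [Cl⁺(K_m) : Cl⁺(K_m)^p] ≤ B` for ALL `m` (for `m ≥ n + k`
the index is that of `K_{n+k}`; finitely many layers below). [cite: Fukuda1994, Thm. 1 (2), p. 264] [cite: Washington1997, §13.3 Prop. 13.23] -/
theorem NarrowFukuda.exists_forall_padicValNat_index_le_of_mul_pow_lt (κ : ZpExtension K p) {n₀ n : ℕ}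
    (hκ : TotallyRamifiedFrom κ n₀) (hn : n₀ ≤ n) {j k : ℕ} (hjk : j ≤ k)
    [NumberField (κ.layer (n + j))] [NumberField (κ.layer (n + k))]
    (hjump : (powMonoidHom (α := NarrowClassGroup (κ.layer (n + k))) p).range.index * p ^ (p ^ j) <
      (powMonoidHom (α := NarrowClassGroup (κ.layer (n + j))) p).range.index * p ^ (p ^ k)) :
    ∃ B : ℕ, ∀ m : ℕ, ∀ [NumberField (κ.layer m)],
      padicValNat p (powMonoidHom (α := NarrowClassGroup (κ.layer m)) p).range.index ≤ B := by
  classical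
  have hinst : ∀ m : ℕ, NumberField (κ.layer m) := fun m =>
    haveI : FiniteDimensional K (κ.layer m) := κ.finiteDimensional_layer_holds m
    NumberField.of_module_finite K _
  let f : ℕ → ℕ := fun m => by
    haveI := hinst m
    exact padicValNat p (powMonoidHom (α := NarrowClassGroup (κ.layer m)) p).range.index
  refine ⟨(Finset.range (n + k + 1)).sup f, fun m _ => ?_⟩
  rcases le_or_gt m (n + k) with hmn | hmn
  · have hfm : padicValNat p (powMonoidHom (α := NarrowClassGroup (κ.layer m)) p).range.index = f m := rfl
    rw [hfm]
    exact Finset.le_sup (f := f) (Finset.mem_range.mpr (Nat.lt_succ_of_le hmn))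
  · rw [NarrowFukuda.index_range_pow_narrowClassGroup_eq_of_mul_pow_lt κ hκ hn hjk hjump hmn.le]
    have hfn : padicValNat p (powMonoidHom (α := NarrowClassGroup (κ.layer (n + k))) p).range.index = f (n + k) := rfl
    rw [hfn]
    exact Finset.le_sup (f := f) (Finset.mem_range.mpr (Nat.lt_succ_self (n + k)))

/-- ★ **Iwasawa's `μ = 0` from a small NARROW rank jump**: under `TotallyRamifiedFrom κ n₀`, `n₀ ≤ n`, `j ≤ k` and
`[Cl⁺(K_{n+k}) : (Cl⁺)^p] · p^{p^j} < [Cl⁺(K_{n+j}) : (Cl⁺)^p] · p^{p^k}`, the narrow `p`-ranks are bounded, hence so are the `p`-ranks of the class groups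
(`[Cl : Cl^p] ∣ [Cl⁺ : (Cl⁺)^p]`), hence `ClassicalMuVanishes κ`. [cite: Fukuda1994, Thm. 1 (2), p. 264] [cite: Washington1997, §13.3 Prop. 13.23] -/
theorem NarrowFukuda.classicalMuVanishes_of_mul_pow_lt (κ : ZpExtension K p) {n₀ n : ℕ}
    (hκ : TotallyRamifiedFrom κ n₀) (hn : n₀ ≤ n) {j k : ℕ} (hjk : j ≤ k)
    [NumberField (κ.layer (n + j))] [NumberField (κ.layer (n + k))]
    (hjump : (powMonoidHom (α := NarrowClassGroup (κ.layer (n + k))) p).range.index * p ^ (p ^ j) <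
      (powMonoidHom (α := NarrowClassGroup (κ.layer (n + j))) p).range.index * p ^ (p ^ k)) :
    ClassicalMuVanishes κ := by
  classical
  obtain ⟨B, hB⟩ := NarrowFukuda.exists_forall_padicValNat_index_le_of_mul_pow_lt κ hκ hn hjk hjump
  refine classicalMuVanishes_of_forall_classGroupPRank_le κ (B := B) fun m => ?_
  haveI : FiniteDimensional K (κ.layer m) := κ.finiteDimensional_layer_holds m
  haveI : NumberField (κ.layer m) := NumberField.of_module_finite K _
  haveI : Finite (NarrowClassGroup (κ.layer m)) := Literature.NumberTheory.GaloisRepresentations.finite_rayClassGroup top_ne_bot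
  have hidx0 : (powMonoidHom (α := NarrowClassGroup (κ.layer m)) p).range.index ≠ 0 := Subgroup.index_ne_zero_of_finite
  refine le_trans ?_ (hB m)
  rw [classGroupPRank_def, ← Subgroup.index_eq_card]
  exact (padicValNat_dvd_iff_le hidx0).mp
    (pow_padicValNat_dvd.trans (index_range_pow_classGroup_dvd_narrowClassGroup (K := ↥(κ.layer m)) p))

/-- **Bounded narrow defect at `p = 2` from a small narrow rank jump**: there is `D` with `ord₂ h⁺(K_m) ≤ ord₂ h(K_m) + D` for ALL `m`
(`ord₂ (h⁺/h) ≤ rank₂ Cl⁺`, tree `padicValNat_two_narrowClassNumber_le`). [cite: Fukuda1994, Thm. 1 (2), p. 264]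
[cite: FrohlichTaylor1990, Ch. V §1 (1.8)–(1.13), pp. 163–164] -/
theorem NarrowFukuda.exists_narrowDefect_le_of_mul_pow_lt (κ : ZpExtension K 2) {n₀ n : ℕ}
    (hκ : TotallyRamifiedFrom κ n₀) (hn : n₀ ≤ n) {j k : ℕ} (hjk : j ≤ k)
    [NumberField (κ.layer (n + j))] [NumberField (κ.layer (n + k))]
    (hjump : (powMonoidHom (α := NarrowClassGroup (κ.layer (n + k))) 2).range.index * 2 ^ (2 ^ j) <
      (powMonoidHom (α := NarrowClassGroup (κ.layer (n + j))) 2).range.index * 2 ^ (2 ^ k)) :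
    ∃ D : ℕ, ∀ m : ℕ, ∀ [NumberField (κ.layer m)],
      padicValNat 2 (narrowClassNumber (κ.layer m)) ≤ padicValNat 2 (classNumber (κ.layer m)) + D := by
  haveI : Fact (Nat.Prime 2) := ⟨Nat.prime_two⟩
  obtain ⟨B, hB⟩ := NarrowFukuda.exists_forall_padicValNat_index_le_of_mul_pow_lt κ hκ hn hjk hjump
  refine ⟨B, fun m _ => ?_⟩
  exact (padicValNat_two_narrowClassNumber_le (K := ↥(κ.layer m))).trans (Nat.add_le_add_left (hB m) _)

/-- ★★ **The small narrow jump, packaged for Kida-lite** (`p = 2`): Fukuda index `n₀ ≤ n`, `j ≤ k`, and a narrow rank jump `< 2^k − 2^j` between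
the layers `n + j` and `n + k` give BOTH (a) Iwasawa's `μ₂ = 0` for `κ` and (b) a bounded narrow `2`-defect `ord₂ h⁺(K_m) − ord₂ h(K_m) ≤ D` —
the two hypotheses of the ascent `K ↦ K(√−1)` (cell bsd-2adic `classicalMu_sup_adjoin_of_sq_eq_neg_one_of_narrowDefect_le`).
[cite: Fukuda1994, Thm. 1 (2), p. 264] [cite: Kida1982JFields, main theorem (μ-part; shape only)] -/
theorem NarrowFukuda.classicalMuVanishes_and_exists_narrowDefect_le_of_mul_pow_lt (κ : ZpExtension K 2) {n₀ n : ℕ}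
    (hκ : TotallyRamifiedFrom κ n₀) (hn : n₀ ≤ n) {j k : ℕ} (hjk : j ≤ k)
    [NumberField (κ.layer (n + j))] [NumberField (κ.layer (n + k))]
    (hjump : (powMonoidHom (α := NarrowClassGroup (κ.layer (n + k))) 2).range.index * 2 ^ (2 ^ j) <
      (powMonoidHom (α := NarrowClassGroup (κ.layer (n + j))) 2).range.index * 2 ^ (2 ^ k)) :
    ClassicalMuVanishes κ ∧ ∃ D : ℕ, ∀ m : ℕ, ∀ [NumberField (κ.layer m)],
      padicValNat 2 (narrowClassNumber (κ.layer m)) ≤ padicValNat 2 (classNumber (κ.layer m)) + D :=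
  haveI : Fact (Nat.Prime 2) := ⟨Nat.prime_two⟩
  ⟨NarrowFukuda.classicalMuVanishes_of_mul_pow_lt κ hκ hn hjk hjump,
    NarrowFukuda.exists_narrowDefect_le_of_mul_pow_lt κ hκ hn hjk hjump⟩

/-! ## §3 `p = 2`, layers `n + 1 ⊂ n + 2`: the narrow `2`-rank grows by at most ONE -/

/-- ★ **`p = 2`, `(j,k) = (1,2)`: `[Cl⁺(K_{n+2}) : Cl⁺(K_{n+2})²] ≤ 2·[Cl⁺(K_{n+1}) : Cl⁺(K_{n+1})²]`** (the narrow `2`-rank grows by at most one from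
`K_{n+1}` to `K_{n+2}`, `n ≥ n₀`) ⟹ the narrow `2`-ranks are constant from `K_{n+2}`. [cite: Fukuda1994, Thm. 1 (2), p. 264]
[cite: Washington1997, §13.3 Prop. 13.22–13.23] -/
theorem NarrowFukuda.index_range_pow_narrowClassGroup_eq_of_le_two_mul (κ : ZpExtension K 2) {n₀ n : ℕ}
    (hκ : TotallyRamifiedFrom κ n₀) (hn : n₀ ≤ n) [NumberField (κ.layer (n + 1))] [NumberField (κ.layer (n + 2))]
    (hjump : (powMonoidHom (α := NarrowClassGroup (κ.layer (n + 2))) 2).range.index ≤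
      2 * (powMonoidHom (α := NarrowClassGroup (κ.layer (n + 1))) 2).range.index)
    {m : ℕ} (hm : n + 2 ≤ m) [NumberField (κ.layer m)] :
    (powMonoidHom (α := NarrowClassGroup (κ.layer m)) 2).range.index =
      (powMonoidHom (α := NarrowClassGroup (κ.layer (n + 2))) 2).range.index := by
  haveI : Fact (Nat.Prime 2) := ⟨Nat.prime_two⟩
  haveI : Finite (NarrowClassGroup (κ.layer (n + 1))) := Literature.NumberTheory.GaloisRepresentations.finite_rayClassGroup top_ne_bot
  have h0 : 0 < (powMonoidHom (α := NarrowClassGroup (κ.layer (n + 1))) 2).range.index :=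
    Nat.pos_of_ne_zero Subgroup.index_ne_zero_of_finite
  refine NarrowFukuda.index_range_pow_narrowClassGroup_eq_of_mul_pow_lt κ hκ hn (j := 1) (k := 2) one_le_two ?_ hm
  norm_num
  omega

/-- ★★ **`p = 2`: a narrow `2`-rank jump of at most ONE between `K_{n+1}` and `K_{n+2}` (`n ≥ n₀`) ⟹ `μ₂ = 0` AND a bounded narrow `2`-defect** —
«narrow `μ₂⁺`-data» of the tower from ONE inequality (narrow Fukuda needs the equality). [cite: Fukuda1994, Thm. 1 (2), p. 264]
[cite: Kida1982JFields, main theorem (μ-part; shape only)] [cite: FrohlichTaylor1990, Ch. V §1 (1.8)–(1.13), pp. 163–164] -/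
theorem NarrowFukuda.classicalMuVanishes_and_exists_narrowDefect_le_of_le_two_mul (κ : ZpExtension K 2) {n₀ n : ℕ}
    (hκ : TotallyRamifiedFrom κ n₀) (hn : n₀ ≤ n) [NumberField (κ.layer (n + 1))] [NumberField (κ.layer (n + 2))]
    (hjump : (powMonoidHom (α := NarrowClassGroup (κ.layer (n + 2))) 2).range.index ≤
      2 * (powMonoidHom (α := NarrowClassGroup (κ.layer (n + 1))) 2).range.index) :
    ClassicalMuVanishes κ ∧ ∃ D : ℕ, ∀ m : ℕ, ∀ [NumberField (κ.layer m)],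
      padicValNat 2 (narrowClassNumber (κ.layer m)) ≤ padicValNat 2 (classNumber (κ.layer m)) + D := by
  haveI : Fact (Nat.Prime 2) := ⟨Nat.prime_two⟩
  haveI : Finite (NarrowClassGroup (κ.layer (n + 1))) := Literature.NumberTheory.GaloisRepresentations.finite_rayClassGroup top_ne_bot
  have h0 : 0 < (powMonoidHom (α := NarrowClassGroup (κ.layer (n + 1))) 2).range.index :=
    Nat.pos_of_ne_zero Subgroup.index_ne_zero_of_finite
  refine NarrowFukuda.classicalMuVanishes_and_exists_narrowDefect_le_of_mul_pow_lt κ hκ hn (j := 1) (k := 2) one_le_two ?_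
  norm_num
  omega

/-- ★★ **THE NARROW JUMP CERTIFICATE of a number field `F` ⟹ «narrow `μ₂⁺ = 0`» for every cyclotomic `ℤ₂`-extension at once.**  DATA: an index
`n₀` and a bound `B` such that for every cyclotomic `ℤ₂`-extension `κ` of `F`: (i) Fukuda index `n₀`; (ii) `[Cl⁺(F_{n₀+2}) : (Cl⁺)²] ≤ 2·[Cl⁺(F_{n₀+1}) : (Cl⁺)²]`;
(iii) `rank₂ Cl⁺(F_m) ≤ B` for `m ≤ n₀ + 2`.  CONCLUSION: (a) `μ₂ = 0` for every cyclotomic `κ`, (b) `ord₂ h⁺(F_m) ≤ ord₂ h(F_m) + B` for every layer —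
the inputs of `classicalMu_sup_adjoin_of_sq_eq_neg_one_of_narrowDefect_le`.  For a totally real cubic `F` with `n₀ = 0` the data are the narrow
`2`-ranks of `F`, `F(√2)` and `F·ℚ(ζ₁₆)⁺`, with ONE inequality between the last two (the jump-`0` certificate `NarrowFukuda.narrowMu_of_narrowRankCertificate`
at `(0,1)` is impossible as soon as two primes ramify in `F(√2)`, `NarrowRankJumpLayerOne`). [cite: Fukuda1994, Thm. 1 (2), p. 264]
[cite: Kida1982JFields, main theorem (μ-part; shape only)] [cite: GreenbergLNM1716, §5, proof of Prop. 5.14 (p. 122)] -/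
theorem NarrowFukuda.narrowMu_of_narrowJumpCertificate (F : Type) [Field F] [NumberField F] (n₀ B : ℕ)
    (hcert : ∀ κ : ZpExtension F 2, κ.IsCyclotomic →
      TotallyRamifiedFrom κ n₀ ∧
      (∀ [NumberField (κ.layer (n₀ + 1))] [NumberField (κ.layer (n₀ + 2))],
        (powMonoidHom (α := NarrowClassGroup (κ.layer (n₀ + 2))) 2).range.index ≤
          2 * (powMonoidHom (α := NarrowClassGroup (κ.layer (n₀ + 1))) 2).range.index) ∧
      (∀ m : ℕ, m ≤ n₀ + 2 → ∀ [NumberField (κ.layer m)],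
        padicValNat 2 (powMonoidHom (α := NarrowClassGroup (κ.layer m)) 2).range.index ≤ B)) :
    (∀ κ : ZpExtension F 2, κ.IsCyclotomic → ClassicalMuVanishes κ) ∧
    (∀ κ : ZpExtension F 2, κ.IsCyclotomic → ∀ m : ℕ, ∀ [NumberField (κ.layer m)],
      padicValNat 2 (narrowClassNumber (κ.layer m)) ≤ padicValNat 2 (classNumber (κ.layer m)) + B) := by
  haveI : Fact (Nat.Prime 2) := ⟨Nat.prime_two⟩
  have key : ∀ κ : ZpExtension F 2, κ.IsCyclotomic → ClassicalMuVanishes κ ∧ ∀ m : ℕ, ∀ [NumberField (κ.layer m)],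
      padicValNat 2 (narrowClassNumber (κ.layer m)) ≤ padicValNat 2 (classNumber (κ.layer m)) + B := by
    intro κ hκc
    obtain ⟨hκ, hr, hB⟩ := hcert κ hκc
    haveI : FiniteDimensional F (κ.layer (n₀ + 1)) := κ.finiteDimensional_layer_holds (n₀ + 1)
    haveI : FiniteDimensional F (κ.layer (n₀ + 2)) := κ.finiteDimensional_layer_holds (n₀ + 2)
    haveI : NumberField (κ.layer (n₀ + 1)) := NumberField.of_module_finite F _
    haveI : NumberField (κ.layer (n₀ + 2)) := NumberField.of_module_finite F _
    have hr' := hr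
    refine ⟨(NarrowFukuda.classicalMuVanishes_and_exists_narrowDefect_le_of_le_two_mul κ hκ le_rfl hr').1, fun m _ => ?_⟩
    refine (padicValNat_two_narrowClassNumber_le (K := ↥(κ.layer m))).trans (Nat.add_le_add_left ?_ _)
    rcases le_or_gt m (n₀ + 2) with hmn | hmn
    · exact hB m hmn
    · rw [NarrowFukuda.index_range_pow_narrowClassGroup_eq_of_le_two_mul κ hκ le_rfl hr' hmn.le]
      exact hB (n₀ + 2) le_rfl
  exact ⟨fun κ hκc => (key κ hκc).1, fun κ hκc => (key κ hκc).2⟩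

end Literature.NumberTheory.IwasawaTheory

end
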